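import Summits.SmoothPoincare4.SmoothPoincare4.Theses.EntropyRung
import Summits.SmoothPoincare4.SmoothPoincare4.Theorems.EntropyRungSubcylindricalExistenceGluingAllScales
import Literature.Geometry.Riemannian.SchrodingerGroundState
import Literature.Topology.FourManifolds.HomotopyS4CompactProofs
import Summits.SmoothPoincare4.SmoothPoincare4.Theorems.EntropyRungSubcylindricalExistenceConformalGroundStatePos
import Summits.SmoothPoincare4.SmoothPoincare4.Theorems.EntropyRungSubcylindricalExistenceCoerciveSchrodingerSolve
import Summits.SmoothPoincare4.SmoothPoincare4.Theorems.EntropyRungSubcylindricalExistenceConformalRealisation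
import Summits.SmoothPoincare4.SmoothPoincare4.Theorems.EntropyRungSubcylindricalExistenceGradSqFlatChart
import Summits.SmoothPoincare4.SmoothPoincare4.Theorems.EntropyRungSubcylindricalExistenceSetIntegralFlatChart
import Summits.SmoothPoincare4.SmoothPoincare4.Theorems.EntropyRungSubcylindricalExistenceRoundClauseEuclidean
import Summits.SmoothPoincare4.SmoothPoincare4.Theorems.EntropyRungSubcylindricalExistenceSphereSideClause
import Summits.SmoothPoincare4.SmoothPoincare4.Theorems.EntropyRungSubcylindricalExistenceCapFactorRound
import Summits.SmoothPoincare4.SmoothPoincare4.Theorems.EntropyRungSubcylindricalExistenceYamabeSobolevOfNonneg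
import Summits.SmoothPoincare4.SmoothPoincare4.Theorems.EntropyRungSubcylindricalExistenceCapMetricVolume
import HarnessLib

/-!
# Stub D `stub_conformalGluing` of line `green-blowup-conformal-entropy` and the REDUCTION of the crux
# `EntropyRung.SubcylindricalExistence` to the transfer stub (stmt-SmoothPoincare4-10871; lead c2, R-c2)

The gluing for Perelman's `μ`-entropy with the EXACTLY ROUND cap. Given (by text) the worker stubs
S0 `stub_gradSqFlatChart`, S0b `stub_setIntegralFlatChart`, S1 `stub_roundClauseEuclidean`,
S2 `stub_sphereSideClause`, S3 `stub_capFactorRound`, S4 `stub_yamabeSobolevOfNonneg`,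
S5 `stub_capMetricVolume` (all landed; S0/S0b/S1 enter only through S2/S3/S5, whose closed forms are
the hypotheses used here), Green data `(g, p, G, a, r)` in Schoen's flat gauge on a closed smooth
homotopy 4-sphere whose blow-up clause holds at level `ν_cyl + δ`, and positive invertibility of
`L_g`, there is a smooth `ψ > 0` with `L_g ψ > 0` such that the clause of `ψ² g` written on `g`
(`e^{−f}`-form, weights `ψ⁴`, `ψ⁻²`, curvature `ψ⁻³L_gψ`) holds at level `ν_cyl + δ'`,
`δ' = min(δ, 0.026)/8`: the analytic content is `gluingAllScales` (choice of `ε, S, Λ, K`, small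
scales by IMS localisation with the exact cap clause and the core comparison, large scales by the
Yamabe–Sobolev propagation); here we only specialise the by-text stubs, take `u₀ = L_g⁻¹ 1` for S4,
and pass from the `w²`-form to the `e^{−f}`-form with `w = e^{−f/2}` (`|∇w|² = ¼ e^{−f}|∇f|²`,
`log w² = −f`).

THE REDUCTION (`subcylindricalExistence_of_blowupExistence`, registered as
`helper_subcylindricalExistenceReduction`): the crux BY NAME from ONE hypothesis, the registered
transfer stub `stub_blowupExistence` (A‴: every closed smooth homotopy 4-sphere carries Green data in
Schoen's flat gauge whose blow-up clears `ν_cyl + δ`; SPC4-hard, NOT asserted here), composing the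
landed C1 `stub_conformalGroundStatePos` and C2 `stub_coerciveSchrodingerSolve` (positive invertibility
of `L_g`, `GreenBlowupReduction.conformalLaplacianSolve`), D (this file, fed the landed S0–S5) and
E `stub_conformalRealisation`. Everything is proved; no definitions, no named facts; the reduction is
CONDITIONAL on A‴ only.
-/

noncomputable section

set_option linter.dupNamespace false

open scoped Manifold ContDiff Topology RealInnerProductSpace ContinuousMap
open Set Filter MeasureTheory
open Literature.Geometry.Lorentzian

namespace Summit.SmoothPoincare4.SmoothPoincare4.Theorems

/-- **Stub D — the gluing for `μ` with the exactly-round cap** (registered stub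
`stub_conformalGluing` of line `green-blowup-conformal-entropy`; see the module docstring).
[cite: Perelman2002Entropy, §3.1] -/
theorem stub_conformalGluing :
    (∀ (M : Type) [TopologicalSpace M] [T2Space M] [SecondCountableTopology M]
      [ChartedSpace (EuclideanSpace ℝ (Fin 4)) M] [IsManifold (𝓡 4) ∞ M] [CompactSpace M]
      [T3Space M] [MeasurableSpace M] [BorelSpace M]
      (g : PseudoRiemannianMetric (𝓡 4) ∞ (EuclideanSpace ℝ (Fin 4)) (TangentSpace (𝓡 4) : M → Type _))
      (p : M) (y : EuclideanSpace ℝ (Fin 4)), y ∈ (extChartAt (𝓡 4) p).target →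
      (∀ X W : EuclideanSpace ℝ (Fin 4),
        g.val ((extChartAt (𝓡 4) p).symm y)
          (mfderiv 𝓘(ℝ, EuclideanSpace ℝ (Fin 4)) (𝓡 4) (extChartAt (𝓡 4) p).symm y X)
          (mfderiv 𝓘(ℝ, EuclideanSpace ℝ (Fin 4)) (𝓡 4) (extChartAt (𝓡 4) p).symm y W) = ⟪X, W⟫) →
      ∀ f : M → ℝ, MDifferentiableAt (𝓡 4) 𝓘(ℝ, ℝ) f ((extChartAt (𝓡 4) p).symm y) →
        g.gradSq f ((extChartAt (𝓡 4) p).symm y) = ‖gradient (f ∘ (extChartAt (𝓡 4) p).symm) y‖ ^ 2) →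
    (∀ (M : Type) [TopologicalSpace M] [T2Space M] [SecondCountableTopology M]
      [ChartedSpace (EuclideanSpace ℝ (Fin 4)) M] [IsManifold (𝓡 4) ∞ M] [CompactSpace M]
      [T3Space M] [MeasurableSpace M] [BorelSpace M]
      (g : PseudoRiemannianMetric (𝓡 4) ∞ (EuclideanSpace ℝ (Fin 4)) (TangentSpace (𝓡 4) : M → Type _))
      [g.HasLeviCivita] (hg : g.IsRiemannian) (p : M) (r : ℝ), 0 < r →
      Metric.closedBall (extChartAt (𝓡 4) p p) r ⊆ (extChartAt (𝓡 4) p).target →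
      (∀ y ∈ Metric.closedBall (extChartAt (𝓡 4) p p) r, ∀ X W : EuclideanSpace ℝ (Fin 4),
        g.val ((extChartAt (𝓡 4) p).symm y)
          (mfderiv 𝓘(ℝ, EuclideanSpace ℝ (Fin 4)) (𝓡 4) (extChartAt (𝓡 4) p).symm y X)
          (mfderiv 𝓘(ℝ, EuclideanSpace ℝ (Fin 4)) (𝓡 4) (extChartAt (𝓡 4) p).symm y W) = ⟪X, W⟫) →
      ∀ F : M → ℝ, Continuous F →
        ∫ x in {x | x ∈ (extChartAt (𝓡 4) p).source ∧
            extChartAt (𝓡 4) p x ∈ Metric.closedBall (extChartAt (𝓡 4) p p) r}, F x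
            ∂(riemannianMeasure (g.toContMDiffRiemannianMetric hg)) =
          ∫ y in Metric.closedBall (extChartAt (𝓡 4) p p) r, F ((extChartAt (𝓡 4) p).symm y)) →
    (∀ (l : ℝ), 0 < l → ∀ τ : ℝ, 0 < τ → ∀ v : EuclideanSpace ℝ (Fin 4) → ℝ, ContDiff ℝ ∞ v →
      HasCompactSupport v →
      ∫ y, (4 * Real.pi * τ) ^ (-(4 : ℝ) / 2) * (v y) ^ 2 * (l * (4 / (l ^ 2 * ‖y‖ ^ 2 + 4))) ^ 4 = 1 →
        Real.log 6 - 2 ≤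
          ∫ y, (τ * (12 * (v y) ^ 2 + 4 * ((l * (4 / (l ^ 2 * ‖y‖ ^ 2 + 4)))⁻¹ ^ 2 * ‖gradient v y‖ ^ 2))
              - (v y) ^ 2 * Real.log ((v y) ^ 2) - 4 * (v y) ^ 2)
              * ((4 * Real.pi * τ) ^ (-(4 : ℝ) / 2) * (l * (4 / (l ^ 2 * ‖y‖ ^ 2 + 4))) ^ 4)) →
    (∀ (M : Type) [TopologicalSpace M] [T2Space M] [SecondCountableTopology M]
      [ChartedSpace (EuclideanSpace ℝ (Fin 4)) M] [IsManifold (𝓡 4) ∞ M] [CompactSpace M]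
      [T3Space M] [MeasurableSpace M] [BorelSpace M]
      (g : PseudoRiemannianMetric (𝓡 4) ∞ (EuclideanSpace ℝ (Fin 4)) (TangentSpace (𝓡 4) : M → Type _))
      [g.HasLeviCivita] (hg : g.IsRiemannian), (∀ x, 0 ≤ g.scalarCurvature x) →
      ∀ (p : M) (G : M → ℝ),
        (ContMDiffOn (𝓡 4) 𝓘(ℝ, ℝ) ∞ G {p}ᶜ ∧ (∀ x, x ≠ p → 0 < G x) ∧
          (∀ x, x ≠ p → g.scalarCurvature x * G x - 6 * g.dalembertian G x = 0) ∧
          Tendsto G (𝓝[≠] p) atTop) →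
      ∀ (a r : ℝ), 0 < a → 0 < r →
        Metric.closedBall (extChartAt (𝓡 4) p p) r ⊆ (extChartAt (𝓡 4) p).target →
        (∀ y ∈ Metric.closedBall (extChartAt (𝓡 4) p p) r, ∀ X W : EuclideanSpace ℝ (Fin 4),
          g.val ((extChartAt (𝓡 4) p).symm y)
            (mfderiv 𝓘(ℝ, EuclideanSpace ℝ (Fin 4)) (𝓡 4) (extChartAt (𝓡 4) p).symm y X)
            (mfderiv 𝓘(ℝ, EuclideanSpace ℝ (Fin 4)) (𝓡 4) (extChartAt (𝓡 4) p).symm y W) = ⟪X, W⟫) →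
        (∀ y ∈ Metric.closedBall (extChartAt (𝓡 4) p p) r, y ≠ extChartAt (𝓡 4) p p →
          G ((extChartAt (𝓡 4) p).symm y) = a / ‖y - extChartAt (𝓡 4) p p‖ ^ 2) →
      ∀ (K : ℝ), 0 < K → ∀ (ψ : M → ℝ), ContMDiff (𝓡 4) 𝓘(ℝ, ℝ) ∞ ψ →
        (∀ x, x ≠ p → ψ x = 4 * K * G x / (4 * K + G x)) → ψ p = 4 * K →
      ∀ τ : ℝ, 0 < τ → ∀ v : M → ℝ, ContMDiff (𝓡 4) 𝓘(ℝ, ℝ) ∞ v →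
        tsupport v ⊆ {x | x ∈ (extChartAt (𝓡 4) p).source ∧
            extChartAt (𝓡 4) p x ∈ Metric.ball (extChartAt (𝓡 4) p p) r} →
        ∫ x, (4 * Real.pi * τ) ^ (-(4 : ℝ) / 2) * (v x) ^ 2 * (ψ x) ^ 4
            ∂(riemannianMeasure (g.toContMDiffRiemannianMetric hg)) = 1 →
          Real.log 6 - 2 ≤
            ∫ x, (τ * ((ψ x ^ 3)⁻¹ * (g.scalarCurvature x * ψ x - 6 * g.dalembertian ψ x) * (v x) ^ 2
                  + 4 * ((ψ x)⁻¹ ^ 2 * g.gradSq v x))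
                - (v x) ^ 2 * Real.log ((v x) ^ 2) - 4 * (v x) ^ 2)
                * ((4 * Real.pi * τ) ^ (-(4 : ℝ) / 2) * (ψ x) ^ 4)
              ∂(riemannianMeasure (g.toContMDiffRiemannianMetric hg))) →
    (∀ (M : Type) [TopologicalSpace M] [T2Space M] [SecondCountableTopology M]
      [ChartedSpace (EuclideanSpace ℝ (Fin 4)) M] [IsManifold (𝓡 4) ∞ M] [CompactSpace M]
      [T3Space M] [MeasurableSpace M] [BorelSpace M]
      (g : PseudoRiemannianMetric (𝓡 4) ∞ (EuclideanSpace ℝ (Fin 4)) (TangentSpace (𝓡 4) : M → Type _))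
      [g.HasLeviCivita], g.IsRiemannian → (∀ x, 0 ≤ g.scalarCurvature x) →
      ∀ (p : M) (G : M → ℝ),
        (ContMDiffOn (𝓡 4) 𝓘(ℝ, ℝ) ∞ G {p}ᶜ ∧ (∀ x, x ≠ p → 0 < G x) ∧
          (∀ x, x ≠ p → g.scalarCurvature x * G x - 6 * g.dalembertian G x = 0) ∧
          Tendsto G (𝓝[≠] p) atTop) →
      ∀ (a r : ℝ), 0 < a → 0 < r →
        Metric.closedBall (extChartAt (𝓡 4) p p) r ⊆ (extChartAt (𝓡 4) p).target →
        (∀ y ∈ Metric.closedBall (extChartAt (𝓡 4) p p) r, ∀ X W : EuclideanSpace ℝ (Fin 4),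
          g.val ((extChartAt (𝓡 4) p).symm y)
            (mfderiv 𝓘(ℝ, EuclideanSpace ℝ (Fin 4)) (𝓡 4) (extChartAt (𝓡 4) p).symm y X)
            (mfderiv 𝓘(ℝ, EuclideanSpace ℝ (Fin 4)) (𝓡 4) (extChartAt (𝓡 4) p).symm y W) = ⟪X, W⟫) →
        (∀ y ∈ Metric.closedBall (extChartAt (𝓡 4) p p) r, y ≠ extChartAt (𝓡 4) p p →
          G ((extChartAt (𝓡 4) p).symm y) = a / ‖y - extChartAt (𝓡 4) p p‖ ^ 2) →
        (∀ x, g.scalarCurvature x = 0 → x ∈ (extChartAt (𝓡 4) p).source ∧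
          extChartAt (𝓡 4) p x ∈ Metric.closedBall (extChartAt (𝓡 4) p p) r) →
      ∀ (K : ℝ), 0 < K →
        ∃ ψ : M → ℝ, ContMDiff (𝓡 4) 𝓘(ℝ, ℝ) ∞ ψ ∧ (∀ x, 0 < ψ x) ∧
          (∀ x, 0 < g.scalarCurvature x * ψ x - 6 * g.dalembertian ψ x) ∧
          (∀ x, x ≠ p → ψ x = 4 * K * G x / (4 * K + G x)) ∧ ψ p = 4 * K) →
    (∀ (M : Type) [TopologicalSpace M] [T2Space M] [SecondCountableTopology M]
      [ChartedSpace (EuclideanSpace ℝ (Fin 4)) M] [IsManifold (𝓡 4) ∞ M] [CompactSpace M]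
      [T3Space M] [MeasurableSpace M] [BorelSpace M]
      (g : PseudoRiemannianMetric (𝓡 4) ∞ (EuclideanSpace ℝ (Fin 4)) (TangentSpace (𝓡 4) : M → Type _))
      [g.HasLeviCivita] (hg : g.IsRiemannian),
      (∃ u₀ : M → ℝ, ContMDiff (𝓡 4) 𝓘(ℝ, ℝ) ∞ u₀ ∧ (∀ x, 0 < u₀ x) ∧
        ∀ x, g.scalarCurvature x * u₀ x - 6 * g.dalembertian u₀ x = 1) →
      ∃ Y : ℝ, 0 < Y ∧ ∀ (ψ : M → ℝ), ContMDiff (𝓡 4) 𝓘(ℝ, ℝ) ∞ ψ → (∀ x, 0 < ψ x) →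
        ∀ (u : M → ℝ), ContMDiff (𝓡 4) 𝓘(ℝ, ℝ) ∞ u →
          Y * Real.sqrt (∫ x, u x ^ 4 * ψ x ^ 4 ∂(riemannianMeasure (g.toContMDiffRiemannianMetric hg))) ≤
            ∫ x, (6 * (ψ x ^ 2 * g.gradSq u x)
                + ψ x * (g.scalarCurvature x * ψ x - 6 * g.dalembertian ψ x) * u x ^ 2)
              ∂(riemannianMeasure (g.toContMDiffRiemannianMetric hg))) →
    (∀ (M : Type) [TopologicalSpace M] [T2Space M] [SecondCountableTopology M]
      [ChartedSpace (EuclideanSpace ℝ (Fin 4)) M] [IsManifold (𝓡 4) ∞ M] [CompactSpace M]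
      [T3Space M] [MeasurableSpace M] [BorelSpace M]
      (g : PseudoRiemannianMetric (𝓡 4) ∞ (EuclideanSpace ℝ (Fin 4)) (TangentSpace (𝓡 4) : M → Type _))
      [g.HasLeviCivita] (hg : g.IsRiemannian) (p : M) (G : M → ℝ),
        (ContMDiffOn (𝓡 4) 𝓘(ℝ, ℝ) ∞ G {p}ᶜ ∧ (∀ x, x ≠ p → 0 < G x) ∧
          (∀ x, x ≠ p → g.scalarCurvature x * G x - 6 * g.dalembertian G x = 0) ∧
          Tendsto G (𝓝[≠] p) atTop) →
      ∀ (a r : ℝ), 0 < a → 0 < r →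
        Metric.closedBall (extChartAt (𝓡 4) p p) r ⊆ (extChartAt (𝓡 4) p).target →
        (∀ y ∈ Metric.closedBall (extChartAt (𝓡 4) p p) r, ∀ X W : EuclideanSpace ℝ (Fin 4),
          g.val ((extChartAt (𝓡 4) p).symm y)
            (mfderiv 𝓘(ℝ, EuclideanSpace ℝ (Fin 4)) (𝓡 4) (extChartAt (𝓡 4) p).symm y X)
            (mfderiv 𝓘(ℝ, EuclideanSpace ℝ (Fin 4)) (𝓡 4) (extChartAt (𝓡 4) p).symm y W) = ⟪X, W⟫) →
        (∀ y ∈ Metric.closedBall (extChartAt (𝓡 4) p p) r, y ≠ extChartAt (𝓡 4) p p →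
          G ((extChartAt (𝓡 4) p).symm y) = a / ‖y - extChartAt (𝓡 4) p p‖ ^ 2) →
      ∃ C₁ C₂ : ℝ, ∀ (K : ℝ), 0 < K → ∀ (ψ : M → ℝ), ContMDiff (𝓡 4) 𝓘(ℝ, ℝ) ∞ ψ →
        (∀ x, x ≠ p → ψ x = 4 * K * G x / (4 * K + G x)) → ψ p = 4 * K →
        ∫ x, (ψ x) ^ 4 ∂(riemannianMeasure (g.toContMDiffRiemannianMetric hg)) ≤ C₁ + C₂ * K ^ 2) →
    ∀ (M : Type) [TopologicalSpace M] [T2Space M] [SecondCountableTopology M]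
      [ChartedSpace (EuclideanSpace ℝ (Fin 4)) M] [IsManifold (𝓡 4) ∞ M] [CompactSpace M]
      [T3Space M] [MeasurableSpace M] [BorelSpace M],
      M ≃ₕ Metric.sphere (0 : EuclideanSpace ℝ (Fin 5)) 1 →
      ∀ (g : PseudoRiemannianMetric (𝓡 4) ∞ (EuclideanSpace ℝ (Fin 4)) (TangentSpace (𝓡 4) : M → Type _))
        [g.HasLeviCivita] (hg : g.IsRiemannian) (p : M) (G : M → ℝ) (a r : ℝ),
        (ContMDiffOn (𝓡 4) 𝓘(ℝ, ℝ) ∞ G {p}ᶜ ∧ (∀ x, x ≠ p → 0 < G x) ∧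
          (∀ x, x ≠ p → g.scalarCurvature x * G x - 6 * g.dalembertian G x = 0) ∧
          Tendsto G (𝓝[≠] p) atTop) →
        (∀ x, 0 ≤ g.scalarCurvature x) →
        (∀ x, g.scalarCurvature x = 0 → x ∈ (extChartAt (𝓡 4) p).source ∧
          extChartAt (𝓡 4) p x ∈ Metric.closedBall (extChartAt (𝓡 4) p p) r) →
        0 < a → 0 < r →
        (Metric.closedBall (extChartAt (𝓡 4) p p) r ⊆ (extChartAt (𝓡 4) p).target ∧
          ∀ y ∈ Metric.closedBall (extChartAt (𝓡 4) p p) r, ∀ X W : EuclideanSpace ℝ (Fin 4),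
            g.val ((extChartAt (𝓡 4) p).symm y)
              (mfderiv 𝓘(ℝ, EuclideanSpace ℝ (Fin 4)) (𝓡 4) (extChartAt (𝓡 4) p).symm y X)
              (mfderiv 𝓘(ℝ, EuclideanSpace ℝ (Fin 4)) (𝓡 4) (extChartAt (𝓡 4) p).symm y W) = ⟪X, W⟫) →
        (∀ y ∈ Metric.closedBall (extChartAt (𝓡 4) p p) r, y ≠ extChartAt (𝓡 4) p p →
          G ((extChartAt (𝓡 4) p).symm y) = a / ‖y - extChartAt (𝓡 4) p p‖ ^ 2) →
        (∃ δ : ℝ, 0 < δ ∧ ∀ τ : ℝ, 0 < τ → ∀ w : M → ℝ, ContMDiff (𝓡 4) 𝓘(ℝ, ℝ) ∞ w →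
          w =ᶠ[𝓝 p] 0 →
          ∫ x, (4 * Real.pi * τ) ^ (-(4 : ℝ) / 2) * (w x) ^ 2 * (G x) ^ 4
              ∂(riemannianMeasure (g.toContMDiffRiemannianMetric hg)) = 1 →
            Real.log 2 + Real.log Real.pi / 2 - 3 / 2 + δ ≤
              ∫ x, (4 * τ * ((G x)⁻¹ ^ 2 * g.gradSq w x) - (w x) ^ 2 * Real.log ((w x) ^ 2)
                  - 4 * (w x) ^ 2) * ((4 * Real.pi * τ) ^ (-(4 : ℝ) / 2) * (G x) ^ 4)
                ∂(riemannianMeasure (g.toContMDiffRiemannianMetric hg))) →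
        (∀ F : M → ℝ, ContMDiff (𝓡 4) 𝓘(ℝ, ℝ) ∞ F → (∀ x, 0 < F x) →
          ∃ ψ : M → ℝ, ContMDiff (𝓡 4) 𝓘(ℝ, ℝ) ∞ ψ ∧ (∀ x, 0 < ψ x) ∧
            ∀ x, g.scalarCurvature x * ψ x - 6 * g.dalembertian ψ x = F x) →
        ∃ ψ : M → ℝ, ContMDiff (𝓡 4) 𝓘(ℝ, ℝ) ∞ ψ ∧ (∀ x, 0 < ψ x) ∧
          (∀ x, 0 < g.scalarCurvature x * ψ x - 6 * g.dalembertian ψ x) ∧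
          ∃ δ : ℝ, 0 < δ ∧ ∀ τ : ℝ, 0 < τ → ∀ f : M → ℝ, ContMDiff (𝓡 4) 𝓘(ℝ, ℝ) ∞ f →
            ∫ x, (4 * Real.pi * τ) ^ (-(4 : ℝ) / 2) * Real.exp (-f x) * ψ x ^ 4
                ∂(riemannianMeasure (g.toContMDiffRiemannianMetric hg)) = 1 →
              Real.log 2 + Real.log Real.pi / 2 - 3 / 2 + δ ≤
                ∫ x, (τ * ((ψ x ^ 3)⁻¹ * (g.scalarCurvature x * ψ x - 6 * g.dalembertian ψ x) +
                      (ψ x ^ 2)⁻¹ * g.gradSq f x) + f x - 4) *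
                    ((4 * Real.pi * τ) ^ (-(4 : ℝ) / 2) * Real.exp (-f x)) * ψ x ^ 4
                  ∂(riemannianMeasure (g.toContMDiffRiemannianMetric hg))
 := by
  intro _ _ _ hS2 hS3 hS4 hS5 M _ _ _ _ _ _ _ _ _ _ g _ hg p G a r hGreen hR0 hRzero ha hr hFlat hGform hBlow hSolve
  obtain ⟨hGs, hGpos, hGeqn, hGlim⟩ := hGreen
  obtain ⟨hsub, hflat⟩ := hFlat
  obtain ⟨δ, hδ, hBlowδ⟩ := hBlow
  -- `u₀ = L_g⁻¹ 1` and the Yamabe–Sobolev constant of the class (S4)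
  obtain ⟨u₀, hu₀, hu₀pos, hLu₀⟩ := hSolve (fun _ ↦ (1 : ℝ)) contMDiff_const (fun _ ↦ one_pos)
  obtain ⟨Y, hY, hYS⟩ := hS4 M g hg ⟨u₀, hu₀, hu₀pos, hLu₀⟩
  -- the specialised stubs S3, S2, S5
  have hfac : ∀ K : ℝ, 0 < K → ∃ ψ : M → ℝ, ContMDiff (𝓡 4) 𝓘(ℝ, ℝ) ∞ ψ ∧ (∀ x, 0 < ψ x) ∧
      (∀ x, 0 < g.scalarCurvature x * ψ x - 6 * g.dalembertian ψ x) ∧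
      (∀ x, x ≠ p → ψ x = 4 * K * G x / (4 * K + G x)) ∧ ψ p = 4 * K :=
    fun K hK ↦ hS3 M g hg hR0 p G ⟨hGs, hGpos, hGeqn, hGlim⟩ a r ha hr hsub hflat hGform hRzero K hK
  have hcapall := fun (K : ℝ) (hK : 0 < K) (ψ : M → ℝ) (hψ : ContMDiff (𝓡 4) 𝓘(ℝ, ℝ) ∞ ψ)
      (hψG : ∀ x, x ≠ p → ψ x = 4 * K * G x / (4 * K + G x)) (hψp : ψ p = 4 * K) ↦
    hS2 M g hg hR0 p G ⟨hGs, hGpos, hGeqn, hGlim⟩ a r ha hr hsub hflat hGform K hK ψ hψ hψG hψp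
  obtain ⟨C₁, C₂, hvol⟩ := hS5 M g hg p G ⟨hGs, hGpos, hGeqn, hGlim⟩ a r ha hr hsub hflat hGform
  -- all scales in `w²`-form
  obtain ⟨ψ, hψ, hψpos, hLψ, hall⟩ := GluingAllScales.allScales_clause g hg hGs hGpos hGlim ha hr hsub hflat
    hGform hδ hBlowδ hY hYS hfac hcapall hvol
  refine ⟨ψ, hψ, hψpos, hLψ, min δ 0.026 / 8, by positivity, ?_⟩
  -- `e^{−f}`-form with `w = e^{−f/2}`
  intro τ hτ f hf hnormf
  exact gluingExpForm M g hg ψ hψpos _ τ hτ (hall τ hτ) f hf hnormf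

/-! ## The reduction: the crux from the transfer stub A‴ -/

namespace GreenBlowupReduction

/-- **Green data make the conformal Laplacian positively invertible.** For Green data `(g, p, G)` on a
closed smooth homotopy 4-sphere and every smooth `F > 0` there is a smooth `ψ > 0` with
`R_g ψ − 6 Δ_g ψ = F`: the ground state of `−Δ_g + R_g/6` (`exists_pos_groundState`) has a positive
eigenvalue by C1 (`stub_conformalGroundStatePos`) and the coercive operator is positively invertible
by C2 (`stub_coerciveSchrodingerSolve`). [cite: LeeParker1987, §2] -/
theorem conformalLaplacianSolve
    (M : Type) [TopologicalSpace M] [T2Space M] [SecondCountableTopology M]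
    [ChartedSpace (EuclideanSpace ℝ (Fin 4)) M] [IsManifold (𝓡 4) ∞ M] [CompactSpace M]
    [T3Space M] [MeasurableSpace M] [BorelSpace M]
    (e : M ≃ₕ Metric.sphere (0 : EuclideanSpace ℝ (Fin 5)) 1)
    (g : PseudoRiemannianMetric (𝓡 4) ∞ (EuclideanSpace ℝ (Fin 4)) (TangentSpace (𝓡 4) : M → Type _))
    [g.HasLeviCivita] (hg : g.IsRiemannian) (p : M) (G : M → ℝ)
    (hGreen : ContMDiffOn (𝓡 4) 𝓘(ℝ, ℝ) ∞ G {p}ᶜ ∧ (∀ x, x ≠ p → 0 < G x) ∧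
      (∀ x, x ≠ p → g.scalarCurvature x * G x - 6 * g.dalembertian G x = 0) ∧
      Tendsto G (𝓝[≠] p) atTop)
    (F : M → ℝ) (hF : ContMDiff (𝓡 4) 𝓘(ℝ, ℝ) ∞ F) (hFpos : ∀ x, 0 < F x) :
    ∃ ψ : M → ℝ, ContMDiff (𝓡 4) 𝓘(ℝ, ℝ) ∞ ψ ∧ (∀ x, 0 < ψ x) ∧
      ∀ x, g.scalarCurvature x * ψ x - 6 * g.dalembertian ψ x = F x := by
  haveI : PathConnectedSpace (Metric.sphere (0 : EuclideanSpace ℝ (Fin 5)) 1) :=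
    Literature.Topology.FourManifolds.pathConnectedSpace_sphere_four
  haveI : PathConnectedSpace M := Literature.Topology.FourManifolds.pathConnectedSpace_of_homotopyEquiv e
  have hV : ContMDiff (𝓡 4) 𝓘(ℝ, ℝ) ∞ (fun x ↦ g.scalarCurvature x / 6) :=
    g.contMDiff_scalarCurvature.div_const 6
  obtain ⟨φ, ev, hφ, hφpos, hpde, hRay⟩ :=
    Literature.Geometry.Riemannian.exists_pos_groundState g (by norm_num) hg hV
  have hev : 0 < ev := stub_conformalGroundStatePos M e g hg p G hGreen φ ev hφ hφpos hpde
  have hF6 : ContMDiff (𝓡 4) 𝓘(ℝ, ℝ) ∞ (fun x ↦ F x / 6) := hF.div_const 6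
  obtain ⟨u, hu, hupos, hueq⟩ :=
    stub_coerciveSchrodingerSolve M g hg (fun x ↦ g.scalarCurvature x / 6) hV ⟨ev, hev, hRay⟩
      (fun x ↦ F x / 6) hF6 (fun x ↦ by have := hFpos x; positivity)
  refine ⟨u, hu, hupos, fun x ↦ ?_⟩
  have h := hueq x
  linear_combination (6 : ℝ) * h

end GreenBlowupReduction

/-- **ENT from blow-up existence in the flat gauge** (line `green-blowup-conformal-entropy`): if every
closed smooth homotopy 4-sphere carries Green data in Schoen's flat gauge whose blow-up clears
`ν_cyl + δ` (the registered transfer stub `stub_blowupExistence`, hypothesis `hA`), then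
`EntropyRung.SubcylindricalExistence` holds. Composition of the landed stubs C1, C2 (through
`GreenBlowupReduction.conformalLaplacianSolve`), D (`stub_conformalGluing`, fed S0–S5) and E
(`stub_conformalRealisation`); pure logic. [cite: LeeParker1987, §§5–7] -/
theorem subcylindricalExistence_of_blowupExistence
    (hA : ∀ (M : Type) [TopologicalSpace M] [T2Space M] [SecondCountableTopology M]
      [ChartedSpace (EuclideanSpace ℝ (Fin 4)) M] [IsManifold (𝓡 4) ∞ M] [CompactSpace M]
      [T3Space M] [MeasurableSpace M] [BorelSpace M],
      M ≃ₕ Metric.sphere (0 : EuclideanSpace ℝ (Fin 5)) 1 →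
      ∃ g : PseudoRiemannianMetric (𝓡 4) ∞ (EuclideanSpace ℝ (Fin 4)) (TangentSpace (𝓡 4) : M → Type _),
      ∃ _ : g.HasLeviCivita, ∃ hg : g.IsRiemannian, ∃ p : M, ∃ G : M → ℝ, ∃ a r : ℝ,
        (ContMDiffOn (𝓡 4) 𝓘(ℝ, ℝ) ∞ G {p}ᶜ ∧ (∀ x, x ≠ p → 0 < G x) ∧
          (∀ x, x ≠ p → g.scalarCurvature x * G x - 6 * g.dalembertian G x = 0) ∧
          Tendsto G (𝓝[≠] p) atTop) ∧
        (∀ x, 0 ≤ g.scalarCurvature x) ∧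
        (∀ x, g.scalarCurvature x = 0 → x ∈ (extChartAt (𝓡 4) p).source ∧
          extChartAt (𝓡 4) p x ∈ Metric.closedBall (extChartAt (𝓡 4) p p) r) ∧
        0 < a ∧ 0 < r ∧
        (Metric.closedBall (extChartAt (𝓡 4) p p) r ⊆ (extChartAt (𝓡 4) p).target ∧
          ∀ y ∈ Metric.closedBall (extChartAt (𝓡 4) p p) r, ∀ X W : EuclideanSpace ℝ (Fin 4),
            g.val ((extChartAt (𝓡 4) p).symm y)
              (mfderiv 𝓘(ℝ, EuclideanSpace ℝ (Fin 4)) (𝓡 4) (extChartAt (𝓡 4) p).symm y X)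
              (mfderiv 𝓘(ℝ, EuclideanSpace ℝ (Fin 4)) (𝓡 4) (extChartAt (𝓡 4) p).symm y W) = ⟪X, W⟫) ∧
        (∀ y ∈ Metric.closedBall (extChartAt (𝓡 4) p p) r, y ≠ extChartAt (𝓡 4) p p →
          G ((extChartAt (𝓡 4) p).symm y) = a / ‖y - extChartAt (𝓡 4) p p‖ ^ 2) ∧
        ∃ δ : ℝ, 0 < δ ∧ ∀ τ : ℝ, 0 < τ → ∀ w : M → ℝ, ContMDiff (𝓡 4) 𝓘(ℝ, ℝ) ∞ w →
          w =ᶠ[𝓝 p] 0 →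
          ∫ x, (4 * Real.pi * τ) ^ (-(4 : ℝ) / 2) * (w x) ^ 2 * (G x) ^ 4
              ∂(riemannianMeasure (g.toContMDiffRiemannianMetric hg)) = 1 →
            Real.log 2 + Real.log Real.pi / 2 - 3 / 2 + δ ≤
              ∫ x, (4 * τ * ((G x)⁻¹ ^ 2 * g.gradSq w x) - (w x) ^ 2 * Real.log ((w x) ^ 2)
                  - 4 * (w x) ^ 2) * ((4 * Real.pi * τ) ^ (-(4 : ℝ) / 2) * (G x) ^ 4)
                ∂(riemannianMeasure (g.toContMDiffRiemannianMetric hg))) :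
    Summit.SmoothPoincare4.SmoothPoincare4.Theses.EntropyRung.SubcylindricalExistence := by
  intro M _ _ _ _ _ _ _ _ _ e
  -- A‴ (hypothesis): Green data in the flat gauge at `p` with super-cylindrical blow-up
  obtain ⟨g, hLC, hg, p, G, a, r, hGreen, hR0, hRzero, ha, hr, hFlat, hGform, hBlow⟩ := hA M e
  -- C (landed): `L_g` is positively invertible
  have hSolve := GreenBlowupReduction.conformalLaplacianSolve M e g hg p G hGreen
  -- D (landed, fed S0–S5): the round-capped conformal factor `ψ`
  obtain ⟨ψ, hψ, hψpos, hLψ, hW⟩ :=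
    stub_conformalGluing stub_gradSqFlatChart stub_setIntegralFlatChart stub_roundClauseEuclidean
      (stub_sphereSideClause stub_gradSqFlatChart stub_setIntegralFlatChart stub_roundClauseEuclidean)
      (stub_capFactorRound stub_gradSqFlatChart) stub_yamabeSobolevOfNonneg
      (stub_capMetricVolume stub_setIntegralFlatChart)
      M e g hg p G a r hGreen hR0 hRzero ha hr hFlat hGform hBlow hSolve
  -- E (landed): realise `ψ² g` and read off `R > 0` and the crux's clause at level `ν_cyl`
  obtain ⟨g', hLC', hg', -, hR', hν'⟩ :=
    stub_conformalRealisation M g hg ψ hψ hψpos hLψ (Real.log 2 + Real.log Real.pi / 2 - 3 / 2) hW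
  exact ⟨g', hLC', hg', hR', hν'⟩

/-- Registered helper `helper_subcylindricalExistenceReduction` of crux stmt-SmoothPoincare4-10871
(the reduction above, as the registered signature: the transfer stub `stub_blowupExistence` implies
the crux). [cite: LeeParker1987, §§5–7] -/
theorem helper_subcylindricalExistenceReduction :
    (∀ (M : Type) [TopologicalSpace M] [T2Space M] [SecondCountableTopology M]
      [ChartedSpace (EuclideanSpace ℝ (Fin 4)) M] [IsManifold (𝓡 4) ∞ M] [CompactSpace M]
      [T3Space M] [MeasurableSpace M] [BorelSpace M],
      M ≃ₕ Metric.sphere (0 : EuclideanSpace ℝ (Fin 5)) 1 →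
      ∃ g : PseudoRiemannianMetric (𝓡 4) ∞ (EuclideanSpace ℝ (Fin 4)) (TangentSpace (𝓡 4) : M → Type _),
      ∃ _ : g.HasLeviCivita, ∃ hg : g.IsRiemannian, ∃ p : M, ∃ G : M → ℝ, ∃ a r : ℝ,
        (ContMDiffOn (𝓡 4) 𝓘(ℝ, ℝ) ∞ G {p}ᶜ ∧ (∀ x, x ≠ p → 0 < G x) ∧
          (∀ x, x ≠ p → g.scalarCurvature x * G x - 6 * g.dalembertian G x = 0) ∧
          Tendsto G (𝓝[≠] p) atTop) ∧
        (∀ x, 0 ≤ g.scalarCurvature x) ∧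
        (∀ x, g.scalarCurvature x = 0 → x ∈ (extChartAt (𝓡 4) p).source ∧
          extChartAt (𝓡 4) p x ∈ Metric.closedBall (extChartAt (𝓡 4) p p) r) ∧
        0 < a ∧ 0 < r ∧
        (Metric.closedBall (extChartAt (𝓡 4) p p) r ⊆ (extChartAt (𝓡 4) p).target ∧
          ∀ y ∈ Metric.closedBall (extChartAt (𝓡 4) p p) r, ∀ X W : EuclideanSpace ℝ (Fin 4),
            g.val ((extChartAt (𝓡 4) p).symm y)
              (mfderiv 𝓘(ℝ, EuclideanSpace ℝ (Fin 4)) (𝓡 4) (extChartAt (𝓡 4) p).symm y X)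
              (mfderiv 𝓘(ℝ, EuclideanSpace ℝ (Fin 4)) (𝓡 4) (extChartAt (𝓡 4) p).symm y W) = ⟪X, W⟫) ∧
        (∀ y ∈ Metric.closedBall (extChartAt (𝓡 4) p p) r, y ≠ extChartAt (𝓡 4) p p →
          G ((extChartAt (𝓡 4) p).symm y) = a / ‖y - extChartAt (𝓡 4) p p‖ ^ 2) ∧
        ∃ δ : ℝ, 0 < δ ∧ ∀ τ : ℝ, 0 < τ → ∀ w : M → ℝ, ContMDiff (𝓡 4) 𝓘(ℝ, ℝ) ∞ w →
          w =ᶠ[𝓝 p] 0 →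
          ∫ x, (4 * Real.pi * τ) ^ (-(4 : ℝ) / 2) * (w x) ^ 2 * (G x) ^ 4
              ∂(riemannianMeasure (g.toContMDiffRiemannianMetric hg)) = 1 →
            Real.log 2 + Real.log Real.pi / 2 - 3 / 2 + δ ≤
              ∫ x, (4 * τ * ((G x)⁻¹ ^ 2 * g.gradSq w x) - (w x) ^ 2 * Real.log ((w x) ^ 2)
                  - 4 * (w x) ^ 2) * ((4 * Real.pi * τ) ^ (-(4 : ℝ) / 2) * (G x) ^ 4)
                ∂(riemannianMeasure (g.toContMDiffRiemannianMetric hg))) →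
    Summit.SmoothPoincare4.SmoothPoincare4.Theses.EntropyRung.SubcylindricalExistence :=
  fun hA ↦ subcylindricalExistence_of_blowupExistence hA

end Summit.SmoothPoincare4.SmoothPoincare4.Theorems

end
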